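import Mathlib

/-!
# Gaussian integrals over `ι → ℂ`, II: integrability and phase rotations

Helper file for route `BECHusimiAmplitudeGas`, support item `LaplaceCapUnion`
(stmt-AtomisticToContinuum-11995). Standard Gaussian weight `e^{-q(c)}`, `q(c) = ∑ᵢ ‖cᵢ‖²`, on
the coefficient space `ι → ℂ` with product Lebesgue measure.

* `integrable_gauss_smul_of_norm_le`: `e^{-q} g` is integrable when `‖g‖ ≤ C (1+q)^k`.
* `integral_comp_rotate`: Lebesgue measure on `ι → ℂ` is invariant under coordinatewise phase
  rotations `cᵢ ↦ uᵢ cᵢ`, `|uᵢ| = 1`.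
* `integral_gauss_pow_mul_conj_prod_eq_zero`: the Gaussian moment
  `∫ e^{-q} c_{i₀}^N conj(∏ⱼ c_{f j}) dc` vanishes unless `f ≡ i₀` (rotate the phase of `c_{i₀}`).
-/

noncomputable section

open MeasureTheory Set
open scoped ENNReal NNReal ComplexConjugate

namespace Summit.AtomisticToContinuum.BoseEinsteinCondensation.Theorems.LaplaceCapUnion

variable {ι : Type*} [Fintype ι]

/-- `‖cᵢ‖ ≤ 1 + q(c)`. [folklore] -/
theorem norm_apply_le_one_add_sum (c : ι → ℂ) (i : ι) : ‖c i‖ ≤ 1 + ∑ j, ‖c j‖ ^ 2 := by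
  have h1 : ‖c i‖ ≤ 1 + ‖c i‖ ^ 2 := by nlinarith [sq_nonneg (‖c i‖ - 1), norm_nonneg (c i)]
  have h2 : ‖c i‖ ^ 2 ≤ ∑ j, ‖c j‖ ^ 2 :=
    Finset.single_le_sum (f := fun j => ‖c j‖ ^ 2) (fun j _ => by positivity) (Finset.mem_univ i)
  linarith

/-- `‖∏ⱼ c_{f j}‖ ≤ (1 + q(c))^N`. [folklore] -/
theorem norm_prod_apply_le {N : ℕ} (c : ι → ℂ) (f : Fin N → ι) :
    ‖∏ j, c (f j)‖ ≤ (1 + ∑ i, ‖c i‖ ^ 2) ^ N := by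
  rw [norm_prod]
  calc ∏ j, ‖c (f j)‖ ≤ ∏ _j : Fin N, (1 + ∑ i, ‖c i‖ ^ 2) :=
        Finset.prod_le_prod (fun j _ => norm_nonneg _) fun j _ => norm_apply_le_one_add_sum c (f j)
    _ = (1 + ∑ i, ‖c i‖ ^ 2) ^ N := by rw [Finset.prod_const, Finset.card_univ, Fintype.card_fin]

/-- `(1+q)^k e^{-q} ≤ 2^k k! e^{1/2} · e^{-q/2}` for `q ≥ 0`. [folklore] -/
theorem one_add_pow_mul_exp_neg_le (k : ℕ) {q : ℝ} (hq : 0 ≤ q) :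
    (1 + q) ^ k * Real.exp (-q) ≤
      (2 ^ k * k.factorial * Real.exp (1 / 2)) * Real.exp (-(q / 2)) := by
  have hy : 0 ≤ (1 + q) / 2 := by positivity
  have hk : (0 : ℝ) < k.factorial := by positivity
  have h1 := Real.pow_div_factorial_le_exp _ hy k
  rw [div_le_iff₀ hk] at h1
  have h2 : (1 + q) ^ k = 2 ^ k * ((1 + q) / 2) ^ k := by
    rw [← mul_pow]; congr 1; ring
  calc (1 + q) ^ k * Real.exp (-q) = 2 ^ k * ((1 + q) / 2) ^ k * Real.exp (-q) := by rw [h2]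
    _ ≤ 2 ^ k * (Real.exp ((1 + q) / 2) * k.factorial) * Real.exp (-q) := by gcongr
    _ = 2 ^ k * k.factorial * Real.exp ((1 + q) / 2 + -q) := by rw [Real.exp_add]; ring
    _ = 2 ^ k * k.factorial * Real.exp (1 / 2 + -(q / 2)) := by congr 2; ring
    _ = (2 ^ k * k.factorial * Real.exp (1 / 2)) * Real.exp (-(q / 2)) := by rw [Real.exp_add]; ring

/-! ### Integrability against the Gaussian weight -/

/-- `z ↦ e^{-|z|²/2}` is integrable on `ℂ`. [folklore] -/
theorem integrable_exp_neg_half_norm_sq : Integrable (fun z : ℂ => Real.exp (-(‖z‖ ^ 2 / 2))) := by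
  have hpos : (0 : ℝ) < 1 / 2 := by norm_num
  have h := GaussianFourier.integral_rexp_neg_mul_sq_norm (V := ℂ) hpos
  have hne : (∫ v : ℂ, Real.exp (-(1 / 2) * ‖v‖ ^ 2)) ≠ 0 := by
    rw [h]; positivity
  have hint := Integrable.of_integral_ne_zero hne
  refine hint.congr (Filter.Eventually.of_forall fun z => ?_)
  ring_nf

/-- `c ↦ e^{-q(c)/2}` is integrable on `ι → ℂ`. [folklore] -/
theorem integrable_exp_neg_half_sum_norm_sq :
    Integrable (fun c : ι → ℂ => Real.exp (-((∑ i, ‖c i‖ ^ 2) / 2))) := by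
  have h := Integrable.fintype_prod (ι := ι) (μ := fun _ : ι => (volume : Measure ℂ))
    (f := fun (_ : ι) (z : ℂ) => Real.exp (-(‖z‖ ^ 2 / 2))) fun _ => integrable_exp_neg_half_norm_sq
  rw [← volume_pi] at h
  refine h.congr (Filter.Eventually.of_forall fun c => ?_)
  simp only
  rw [← Real.exp_sum, Finset.sum_div, ← Finset.sum_neg_distrib]

/-- **Gaussian integrability of polynomially bounded functions**: if `g` is a.e.-strongly
measurable with `‖g(c)‖ ≤ C (1 + q(c))^k`, then `e^{-q} g` is integrable. [folklore] -/
theorem integrable_gauss_smul_of_norm_le {E : Type*} [NormedAddCommGroup E] [NormedSpace ℝ E]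
    {g : (ι → ℂ) → E} (hg : AEStronglyMeasurable g volume) (k : ℕ) (C : ℝ)
    (hle : ∀ c, ‖g c‖ ≤ C * (1 + ∑ i, ‖c i‖ ^ 2) ^ k) :
    Integrable (fun c : ι → ℂ => Real.exp (-(∑ i, ‖c i‖ ^ 2)) • g c) := by
  set K : ℝ := 2 ^ k * k.factorial * Real.exp (1 / 2) with hK_def
  have hdom : Integrable (fun c : ι → ℂ => (|C| * K) * Real.exp (-((∑ i, ‖c i‖ ^ 2) / 2))) :=
    integrable_exp_neg_half_sum_norm_sq.const_mul _
  have hmeas : AEStronglyMeasurable (fun c : ι → ℂ => Real.exp (-(∑ i, ‖c i‖ ^ 2)) • g c) volume :=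
    (Continuous.aestronglyMeasurable (by fun_prop)).smul hg
  refine hdom.mono' hmeas (Filter.Eventually.of_forall fun c => ?_)
  have hq : 0 ≤ ∑ i, ‖c i‖ ^ 2 := Finset.sum_nonneg fun i _ => by positivity
  rw [norm_smul, Real.norm_eq_abs, abs_of_pos (Real.exp_pos _)]
  have hpow : 0 ≤ (1 + ∑ i, ‖c i‖ ^ 2) ^ k := by positivity
  calc Real.exp (-(∑ i, ‖c i‖ ^ 2)) * ‖g c‖
      ≤ Real.exp (-(∑ i, ‖c i‖ ^ 2)) * (|C| * (1 + ∑ i, ‖c i‖ ^ 2) ^ k) := by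
        gcongr
        exact (hle c).trans (mul_le_mul_of_nonneg_right (le_abs_self C) hpow)
    _ = |C| * ((1 + ∑ i, ‖c i‖ ^ 2) ^ k * Real.exp (-(∑ i, ‖c i‖ ^ 2))) := by ring
    _ ≤ |C| * (K * Real.exp (-((∑ i, ‖c i‖ ^ 2) / 2))) :=
        mul_le_mul_of_nonneg_left (one_add_pow_mul_exp_neg_le k hq) (abs_nonneg C)
    _ = |C| * K * Real.exp (-((∑ i, ‖c i‖ ^ 2) / 2)) := by ring

/-- Complex-valued form: `e^{-q} g` integrable for `‖g‖ ≤ C (1+q)^k`. [folklore] -/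
theorem integrable_gauss_mul_of_norm_le {g : (ι → ℂ) → ℂ} (hg : AEStronglyMeasurable g volume)
    (k : ℕ) (C : ℝ) (hle : ∀ c, ‖g c‖ ≤ C * (1 + ∑ i, ‖c i‖ ^ 2) ^ k) :
    Integrable (fun c : ι → ℂ => (Real.exp (-(∑ i, ‖c i‖ ^ 2)) : ℂ) * g c) := by
  have h := integrable_gauss_smul_of_norm_le hg k C hle
  refine h.congr (Filter.Eventually.of_forall fun c => ?_)
  simp only [Complex.real_smul]

/-- Real-valued form: `e^{-q} g` integrable for `|g| ≤ C (1+q)^k`. [folklore] -/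
theorem integrable_gauss_mul_real_of_norm_le {g : (ι → ℂ) → ℝ} (hg : AEStronglyMeasurable g volume)
    (k : ℕ) (C : ℝ) (hle : ∀ c, ‖g c‖ ≤ C * (1 + ∑ i, ‖c i‖ ^ 2) ^ k) :
    Integrable (fun c : ι → ℂ => Real.exp (-(∑ i, ‖c i‖ ^ 2)) * g c) :=
  integrable_gauss_smul_of_norm_le hg k C hle

/-! ### Phase rotations -/

/-- **Rotation invariance**: Lebesgue measure on `ι → ℂ` is preserved by `cᵢ ↦ uᵢ cᵢ` with
`|uᵢ| = 1`, hence `∫ g(u · c) dc = ∫ g(c) dc`. [folklore] -/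
theorem integral_comp_rotate {E : Type*} [NormedAddCommGroup E] [NormedSpace ℝ E]
    (u : ι → Circle) (g : (ι → ℂ) → E) :
    ∫ c : ι → ℂ, g (fun i => (u i : ℂ) * c i) = ∫ c, g c := by
  let e : (ι → ℂ) ≃ᵐ (ι → ℂ) :=
    MeasurableEquiv.piCongrRight fun i => (rotation (u i)).toHomeomorph.toMeasurableEquiv
  have he : (e : (ι → ℂ) → (ι → ℂ)) = fun c i => (u i : ℂ) * c i := rfl
  have hmp : MeasurePreserving e volume volume := by
    rw [he]
    exact volume_preserving_pi fun i => (rotation (u i)).measurePreserving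
  have h := hmp.integral_comp e.measurableEmbedding g
  rw [he] at h
  exact h

/-- **Vanishing Gaussian moments.** For `f : Fin N → ι` not identically `i₀`,
`∫ e^{-q(c)} c_{i₀}^N conj(∏ⱼ c_{f j}) dc = 0`: rotating the phase of `c_{i₀}` by `ω` with
`ω^{N-m} = -1`, `m = #{j | f j = i₀} < N`, flips the sign of the integral. [folklore] -/
theorem integral_gauss_pow_mul_conj_prod_eq_zero [DecidableEq ι] (i₀ : ι) {N : ℕ}
    {f : Fin N → ι} (hf : f ≠ fun _ => i₀) :
    ∫ c : ι → ℂ, (Real.exp (-(∑ i, ‖c i‖ ^ 2)) : ℂ) * (c i₀ ^ N * conj (∏ j, c (f j))) = 0 := by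
  classical
  set m : ℕ := (Finset.univ.filter fun j => f j = i₀).card with hm_def
  have hmN : m < N := by
    obtain ⟨j, hj⟩ : ∃ j, f j ≠ i₀ := by
      by_contra h
      push Not at h
      exact hf (funext h)
    have hss : (Finset.univ.filter fun j => f j = i₀) ⊂ Finset.univ := by
      rw [Finset.ssubset_univ_iff]
      intro h
      have hmem : j ∈ Finset.univ.filter fun j => f j = i₀ := by
        rw [h]; exact Finset.mem_univ j
      exact hj (Finset.mem_filter.1 hmem).2
    have := Finset.card_lt_card hss
    rwa [Finset.card_univ, Fintype.card_fin] at this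
  set k : ℕ := N - m with hk_def
  have hk : 0 < k := Nat.sub_pos_of_lt hmN
  have hNkm : N = k + m := by omega
  -- the rotation angle
  set ω : Circle := Circle.exp (Real.pi / k) with hω_def
  have hkC : (k : ℂ) ≠ 0 := by exact_mod_cast hk.ne'
  have hωk : (ω : ℂ) ^ k = -1 := by
    rw [hω_def, Circle.coe_exp, ← Complex.exp_nat_mul, Complex.ofReal_div, Complex.ofReal_natCast]
    rw [show (k : ℂ) * (Real.pi / k * Complex.I) = Real.pi * Complex.I by
      field_simp]
    exact Complex.exp_pi_mul_I
  let u : ι → Circle := fun i => if i = i₀ then ω else 1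
  set g : (ι → ℂ) → ℂ := fun c =>
    (Real.exp (-(∑ i, ‖c i‖ ^ 2)) : ℂ) * (c i₀ ^ N * conj (∏ j, c (f j))) with hg_def
  -- the integrand at the rotated point
  have hpt : ∀ c : ι → ℂ, g (fun i => (u i : ℂ) * c i) = (ω : ℂ) ^ k * g c := by
    intro c
    have hn : ∀ i, ‖(u i : ℂ) * c i‖ = ‖c i‖ := fun i => by
      rw [norm_mul, Circle.norm_coe, one_mul]
    have hu0 : (u i₀ : ℂ) = ω := by simp [u]
    have hprod : ∏ j, ((u (f j) : ℂ) * c (f j)) = (ω : ℂ) ^ m * ∏ j, c (f j) := by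
      rw [Finset.prod_mul_distrib]
      congr 1
      have hu : ∀ j, ((u (f j) : Circle) : ℂ) = if f j = i₀ then (ω : ℂ) else 1 := fun j => by
        by_cases h : f j = i₀ <;> simp [u, h]
      simp_rw [hu]
      rw [Finset.prod_ite, Finset.prod_const, Finset.prod_const_one, mul_one]
    simp only [hg_def, hn, hu0]
    rw [hprod, mul_pow, map_mul, map_pow, ← Circle.coe_inv_eq_conj, Circle.coe_inv]
    have hωN : (ω : ℂ) ^ N = (ω : ℂ) ^ k * (ω : ℂ) ^ m := by rw [← pow_add, ← hNkm]
    have hω0 : (ω : ℂ) ≠ 0 := Circle.coe_ne_zero ω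
    have hωm : ((ω : ℂ) ^ m)⁻¹ * (ω : ℂ) ^ m = 1 := inv_mul_cancel₀ (pow_ne_zero m hω0)
    rw [hωN, inv_pow]
    calc _ = (ω : ℂ) ^ k * ((Real.exp (-(∑ x, ‖c x‖ ^ 2)) : ℂ) * (c i₀ ^ N * conj (∏ j, c (f j)))) *
          (((ω : ℂ) ^ m)⁻¹ * (ω : ℂ) ^ m) := by ring
      _ = _ := by rw [hωm, mul_one]
  have key : ∫ c : ι → ℂ, (ω : ℂ) ^ k * g c = ∫ c, g c := by
    rw [← integral_comp_rotate u g]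
    exact integral_congr_ae (Filter.Eventually.of_forall fun c => (hpt c).symm)
  rw [integral_const_mul, hωk, neg_one_mul] at key
  exact add_self_eq_zero.1 (neg_eq_iff_add_eq_zero.1 key)


/-! ### Conversions and small facts used downstream -/

/-- `(‖z‖₊ : ℝ≥0∞)^n = ofReal (‖z‖^n)`. [folklore] -/
theorem coe_nnnorm_pow_eq_ofReal {E : Type*} [SeminormedAddCommGroup E] (z : E) (n : ℕ) :
    ((‖z‖₊ : ℝ≥0∞) ^ n) = ENNReal.ofReal (‖z‖ ^ n) := by
  rw [ENNReal.ofReal_pow (norm_nonneg _), ofReal_norm, enorm_eq_nnnorm]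

/-- `∫⁻ e^{-q} (‖g‖₊)^n`-type conversions: for an integrable nonnegative real density,
`∫⁻ ofReal(e^{-q}) · ofReal(h) = ofReal(∫ e^{-q} h)`. [folklore] -/
theorem lintegral_gauss_mul_ofReal_eq {h : (ι → ℂ) → ℝ} (hnn : ∀ c, 0 ≤ h c)
    (hint : Integrable (fun c : ι → ℂ => Real.exp (-(∑ i, ‖c i‖ ^ 2)) * h c)) :
    ∫⁻ c : ι → ℂ, ENNReal.ofReal (Real.exp (-(∑ i, ‖c i‖ ^ 2))) * ENNReal.ofReal (h c) =
      ENNReal.ofReal (∫ c : ι → ℂ, Real.exp (-(∑ i, ‖c i‖ ^ 2)) * h c) := by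
  rw [ofReal_integral_eq_lintegral_ofReal hint
    (Filter.Eventually.of_forall fun c => mul_nonneg (Real.exp_pos _).le (hnn c))]
  refine lintegral_congr fun c => ?_
  rw [← ENNReal.ofReal_mul (Real.exp_pos _).le]

/-- `∫ e^{-q} |c_{i₀}|^n > 0`. [folklore] -/
theorem lintegral_gauss_pow_ne_zero (i₀ : ι) (n : ℕ) :
    ∫⁻ c : ι → ℂ, ENNReal.ofReal (Real.exp (-(∑ i, ‖c i‖ ^ 2))) * ((‖c i₀‖₊ : ℝ≥0∞) ^ n) ≠ 0 := by
  have hmeas : Measurable fun c : ι → ℂ =>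
      ENNReal.ofReal (Real.exp (-(∑ i, ‖c i‖ ^ 2))) * ((‖c i₀‖₊ : ℝ≥0∞) ^ n) :=
    (Measurable.ennreal_ofReal (by fun_prop)).mul
      ((measurable_pi_apply i₀).nnnorm.coe_nnreal_ennreal.pow_const n)
  rw [Ne, lintegral_eq_zero_iff hmeas]
  intro h
  have hU : volume {c : ι → ℂ | c i₀ ≠ 0} ≠ 0 := by
    have hopen : IsOpen {c : ι → ℂ | c i₀ ≠ 0} := isOpen_ne_fun (continuous_apply i₀) continuous_const
    have hne : ({c : ι → ℂ | c i₀ ≠ 0}).Nonempty := ⟨fun _ => 1, by simp⟩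
    exact (hopen.measure_pos volume hne).ne'
  refine hU (measure_mono_null (fun c hc => ?_) (ae_iff.1 h))
  simp only [Set.mem_setOf_eq] at hc ⊢
  simp only [Pi.zero_apply]
  refine mul_ne_zero (ENNReal.ofReal_pos.2 (Real.exp_pos _)).ne' (pow_ne_zero _ ?_)
  rwa [Ne, ENNReal.coe_eq_zero, nnnorm_eq_zero]

/-- `1/8 = ofReal (1/8)` in `ℝ≥0∞`. [folklore] -/
theorem one_div_eight_eq_ofReal : (1 / 8 : ℝ≥0∞) = ENNReal.ofReal (1 / 8) := by
  rw [ENNReal.ofReal_div_of_pos (by norm_num), ENNReal.ofReal_one, ENNReal.ofReal_ofNat]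

/-- `3/4 = ofReal (3/4)` in `ℝ≥0∞`. [folklore] -/
theorem three_div_four_eq_ofReal : (3 / 4 : ℝ≥0∞) = ENNReal.ofReal (3 / 4) := by
  rw [ENNReal.ofReal_div_of_pos (by norm_num), ENNReal.ofReal_ofNat, ENNReal.ofReal_ofNat]


end Summit.AtomisticToContinuum.BoseEinsteinCondensation.Theorems.LaplaceCapUnion
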